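import Literature.InformationTheory.Coding.PolarizationTree
import Literature.InformationTheory.Coding.SourcePolarizationFine
import Literature.InformationTheory.Coding.SourcePolarizationRough
import HarnessLib

/-!
# Rough polarization of an abstract `(minus, plus)`-tree with a polynomially small unpolarized fraction

Topic `Literature/InformationTheory/Coding`; theorem-only companion of
`Literature/InformationTheory/Coding/PolarizationTree.lean` (`leaf`, `StepBounds`).  The ROUGH
polarization theorem in the abstract setting of Arıkan's one-step relations: there are ABSOLUTE
constants `μ > 0`, `C` (here `μ = 1/80`, `C = 2`) such that for every type `𝒮`, every
`P : StepBounds 𝒮` (`H⁻ + H⁺ = 2H`, `Z⁺ = Z²`, `Z√(2−Z²) ≤ Z⁻ ≤ 2Z − Z²`, `Z² ≤ H ≤ log₂(1+Z)`),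
every root `h` and every depth `s`, at most `C · 2^{(1−μ)s}` of the `2^s` leaves
`leaf P.minus P.plus s h j` have `P.H ∈ (2^{-μ s}, 1 − 2^{-μ s})` (`rough_polarization`)
[Arıkan 2010, Thm 1 (source polarization) with Prop. 1–2; the universal polynomial rate in the
shape of Guruswami–Xia 2015 ("rough polarization") and Mondelli–Hassani–Urbanke 2016, Lemmas 5–6].
The instance `𝒮 = Src` (binary sources with functional side information,
`Literature/InformationTheory/Coding/SourcePolarizationTree.lean`) is the source-polarization
theorem `PolarizeRough_holds` of `Literature/InformationTheory/Coding/SourcePolarizationRough.lean`,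
whose argument we repeat verbatim for an abstract `StepBounds`.

## The argument

* `leaf` is the tree `tleaf` of `Literature/InformationTheory/Coding/SourcePolarizationFine.lean`
  (`leaf_eq_tleaf`), so the generic potential bound `sum_tleaf_le_pow` applies.
* POTENTIAL `ψ(z) = √(z(1 − z²))`: from `Z⁺ = Z²`, `ψ(Z⁺) = √(Z(1+Z²)) ψ(Z)`
  (`sqrt_sq_mul_one_sub_eq`); from `Z√(2−Z²) ≤ Z⁻ ≤ 2Z − Z²`, `ψ(Z⁻) ≤ √((2−Z)(1−Z²)) ψ(Z)`
  (`sqrt_mul_one_sub_sq_le`); and `√(z(1+z²)) + √((2−z)(1−z²)) ≤ 19/10` on `[0,1]`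
  (`sqrt_add_sqrt_le`): ONE-STEP CONTRACTION `ψ(Z⁻) + ψ(Z⁺) ≤ (19/10) ψ(Z)` (`sqrt_step_le`), hence
  `Σ_leaves ψ ≤ (19/10)^s` (`sum_sqrt_leaf_le`).
* LEAVES: `ε < H < 1 − ε` forces `ψ(Z) ≥ ε/2` (`H ≤ log₂(1+Z)` gives `Z ≥ 2^ε − 1 ≥ ε ln 2`, and
  `Z² ≤ H` gives `1 − Z² ≥ ε`; `half_eps_le_sqrt`), so by Markov
  `#{unpolarized leaves} · ε/2 ≤ (19/10)^s` (`card_window_mul_le`).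
* RATES: `ε = 2^{-s/80}` and `(39/20) 2^{1/80} ≤ 2^{79/80}` (`rate_pow_le`).

## References

* E. Arıkan, *Source polarization*, Proc. IEEE ISIT 2010, Thm 1, Prop. 1–2.  bib `Arikan2010`.
* V. Guruswami, P. Xia, *Polar codes: speed of polarization and polynomial gap to capacity*, IEEE
  Trans. IT 61 (2015), §"rough polarization".  bib `GuruswamiXia2015`.
* M. Mondelli, S. H. Hassani, R. Urbanke, *Unified scaling of polar codes*, IEEE Trans. IT 62
  (2016), Lemmas 5–6.  bib `MondelliHassaniUrbanke2016`.
-/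

namespace Literature.InformationTheory.Coding.PolarTree

open Finset Literature.InformationTheory.Coding.Polar

universe u

variable {𝒮 : Type u}

/-! ### `leaf` is `tleaf` -/

/-- The leaves of `PolarizationTree.lean` are the leaves `tleaf` of `SourcePolarizationFine.lean`
(same recursion, arguments in a different order). [folklore] -/
theorem leaf_eq_tleaf (minus plus : 𝒮 → 𝒮) : ∀ (s : ℕ) (h : 𝒮) (j : Fin (2 ^ s)),
    leaf minus plus s h j = tleaf minus plus h s j
  | 0, _, _ => rfl
  | s + 1, h, j => by
    simp only [leaf, tleaf]
    split_ifs with hj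
    · exact leaf_eq_tleaf minus plus s (minus h) _
    · exact leaf_eq_tleaf minus plus s (plus h) _

/-- Low leaves: `leaf (s+1) h (loIdx c) = leaf s (minus h) c`. [folklore] -/
@[simp] theorem leaf_succ_loIdx (minus plus : 𝒮 → 𝒮) (s : ℕ) (h : 𝒮) (c : Fin (2 ^ s)) :
    leaf minus plus (s + 1) h (loIdx s c) = leaf minus plus s (minus h) c := by
  simp [leaf, loIdx]

/-- High leaves: `leaf (s+1) h (hiIdx c) = leaf s (plus h) c`. [folklore] -/
@[simp] theorem leaf_succ_hiIdx (minus plus : 𝒮 → 𝒮) (s : ℕ) (h : 𝒮) (c : Fin (2 ^ s)) :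
    leaf minus plus (s + 1) h (hiIdx s c) = leaf minus plus s (plus h) c := by
  simp [leaf, hiIdx]

/-- Splitting a sum over the leaves at depth `s + 1` on the first step. [folklore] -/
theorem sum_leaf_succ {M : Type*} [AddCommMonoid M] (minus plus : 𝒮 → 𝒮) (F : 𝒮 → M) (s : ℕ)
    (h : 𝒮) : ∑ j : Fin (2 ^ (s + 1)), F (leaf minus plus (s + 1) h j) =
      ∑ j : Fin (2 ^ s), F (leaf minus plus s (minus h) j) +
        ∑ j : Fin (2 ^ s), F (leaf minus plus s (plus h) j) := by
  rw [sum_univ_two_pow_succ]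
  simp

/-- Leaves compose: the leaves at depth `s₁ + s₂` are the depth-`s₂` leaves below the depth-`s₁`
leaves (stated for sums over the leaves). [folklore] -/
theorem sum_leaf_add {M : Type*} [AddCommMonoid M] (minus plus : 𝒮 → 𝒮) (F : 𝒮 → M)
    (s₁ s₂ : ℕ) (h : 𝒮) : ∑ j : Fin (2 ^ (s₁ + s₂)), F (leaf minus plus (s₁ + s₂) h j) =
      ∑ i : Fin (2 ^ s₁), ∑ j : Fin (2 ^ s₂), F (leaf minus plus s₂ (leaf minus plus s₁ h i) j) := by
  simp only [leaf_eq_tleaf]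
  exact sum_tleaf_add minus plus F s₁ s₂ h

/-! ### The potential `ψ(Z) = √(Z(1 − Z²))` along an abstract polarization step -/

namespace StepBounds

variable (P : StepBounds 𝒮)

/-- **One-step contraction of the potential** `ψ(z) = √(z(1 − z²))` under Arıkan's one-step
relations: `ψ(Z(minus h)) + ψ(Z(plus h)) ≤ (19/10) · ψ(Z h)`, from `Z⁺ = Z²` and
`Z√(2 − Z²) ≤ Z⁻ ≤ 2Z − Z²` alone.
[cite: MondelliHassaniUrbanke2016, Lemmas 5–6 (potential contraction from the one-step range)] -/
theorem sqrt_step_le (h : 𝒮) :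
    Real.sqrt (P.Z (P.minus h) * (1 - P.Z (P.minus h) ^ 2)) +
        Real.sqrt (P.Z (P.plus h) * (1 - P.Z (P.plus h) ^ 2)) ≤
      19 / 10 * Real.sqrt (P.Z h * (1 - P.Z h ^ 2)) := by
  have hz0 := P.Z_nonneg h
  have hz1 := P.Z_le_one h
  rw [P.Z_plus h, sqrt_sq_mul_one_sub_eq hz0]
  have hminus := sqrt_mul_one_sub_sq_le hz0 hz1 (P.Z_nonneg (P.minus h)) (P.Z_le_one (P.minus h))
    (P.Z_minus_ge h) (P.Z_minus_le h)
  have hψ0 : 0 ≤ Real.sqrt (P.Z h * (1 - P.Z h ^ 2)) := Real.sqrt_nonneg _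
  calc Real.sqrt (P.Z (P.minus h) * (1 - P.Z (P.minus h) ^ 2)) +
          Real.sqrt (P.Z h * (1 + P.Z h ^ 2)) * Real.sqrt (P.Z h * (1 - P.Z h ^ 2))
        ≤ Real.sqrt ((2 - P.Z h) * (1 - P.Z h ^ 2)) * Real.sqrt (P.Z h * (1 - P.Z h ^ 2)) +
          Real.sqrt (P.Z h * (1 + P.Z h ^ 2)) * Real.sqrt (P.Z h * (1 - P.Z h ^ 2)) := by
          linarith
    _ = (Real.sqrt (P.Z h * (1 + P.Z h ^ 2)) + Real.sqrt ((2 - P.Z h) * (1 - P.Z h ^ 2))) *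
          Real.sqrt (P.Z h * (1 - P.Z h ^ 2)) := by ring
    _ ≤ 19 / 10 * Real.sqrt (P.Z h * (1 - P.Z h ^ 2)) :=
        mul_le_mul_of_nonneg_right (sqrt_add_sqrt_le hz0 hz1) hψ0

/-- `ψ(Z h) ≤ 1`. [folklore] -/
theorem sqrt_le_one (h : 𝒮) : Real.sqrt (P.Z h * (1 - P.Z h ^ 2)) ≤ 1 := by
  rw [Real.sqrt_le_left zero_le_one, one_pow]
  have hz0 := P.Z_nonneg h
  have hz1 := P.Z_le_one h
  nlinarith [sq_nonneg (P.Z h)]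

/-- **The potential at an unpolarized node**: if `ε < H h < 1 − ε` then `ε/2 ≤ ψ(Z h)`, because
`H ≤ log₂(1 + Z)` forces `Z ≥ 2^ε − 1 ≥ ε ln 2 ≥ ε/2` and `Z² ≤ H` forces `1 − Z² ≥ ε`.
[cite: Arikan2010, Prop. 2 (Z² ≤ H ≤ log(1+Z): H and Z polarize simultaneously)] -/
theorem half_eps_le_sqrt (h : 𝒮) {ε : ℝ} (hε : 0 < ε) (hlo : ε < P.H h) (hhi : P.H h < 1 - ε) :
    ε / 2 ≤ Real.sqrt (P.Z h * (1 - P.Z h ^ 2)) := by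
  have hz0 := P.Z_nonneg h
  have hlogb : ε < Real.logb 2 (1 + P.Z h) := hlo.trans_le (P.H_le_logb h)
  have hZ : ε / 2 ≤ P.Z h := by
    have h1 : (2 : ℝ) ^ ε < 1 + P.Z h :=
      (Real.lt_logb_iff_rpow_lt one_lt_two (by linarith)).1 hlogb
    have h2 := mul_log_two_le_two_rpow_sub_one ε
    have h3 := half_lt_log_two
    nlinarith
  have hZ2 : ε ≤ 1 - P.Z h ^ 2 := by linarith [P.sq_Z_le_H h]
  rw [Real.le_sqrt (by linarith) (mul_nonneg hz0 (by linarith))]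
  calc (ε / 2) ^ 2 ≤ ε / 2 * ε := by nlinarith
    _ ≤ P.Z h * (1 - P.Z h ^ 2) := mul_le_mul hZ hZ2 hε.le hz0

/-- **Rough polarization, potential form**: the sum of `ψ(Z)` over the `2^s` leaves at depth `s`
is at most `(19/10)^s`. [cite: MondelliHassaniUrbanke2016, Lemma 6 (E[g(Z_n)] decays geometrically)] -/
theorem sum_sqrt_leaf_le (h : 𝒮) (s : ℕ) :
    ∑ j : Fin (2 ^ s), Real.sqrt (P.Z (leaf P.minus P.plus s h j) *
        (1 - P.Z (leaf P.minus P.plus s h j) ^ 2)) ≤ (19 / 10 : ℝ) ^ s := by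
  have hsum := sum_tleaf_le_pow P.minus P.plus (fun a => Real.sqrt (P.Z a * (1 - P.Z a ^ 2)))
    (19 / 10) (by norm_num) (fun a => P.sqrt_step_le a) s h
  simp only [leaf_eq_tleaf]
  exact hsum.trans (mul_le_of_le_one_right (pow_nonneg (by norm_num) s) (P.sqrt_le_one h))

/-- **Markov's inequality along the tree**: for every root `h`, every `ε > 0` and every depth `s`,
`#{j < 2^s : ε < H(leaf j) < 1 − ε} · ε/2 ≤ (19/10)^s`.
[cite: MondelliHassaniUrbanke2016, Lemmas 5–6 (E[(Z_n(1−Z_n))^α] decays geometrically; Markov)] -/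
theorem card_window_mul_le (h : 𝒮) (s : ℕ) {ε : ℝ} (hε : 0 < ε) :
    ((univ.filter fun j : Fin (2 ^ s) =>
        ε < P.H (leaf P.minus P.plus s h j) ∧ P.H (leaf P.minus P.plus s h j) < 1 - ε).card : ℝ) *
        (ε / 2) ≤ (19 / 10 : ℝ) ^ s := by
  rw [Finset.natCast_card_filter, Finset.sum_mul]
  refine le_trans (Finset.sum_le_sum fun j _ => ?_) (P.sum_sqrt_leaf_le h s)
  split_ifs with hj
  · rw [one_mul]
    exact P.half_eps_le_sqrt _ hε hj.1 hj.2
  · rw [zero_mul]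
    exact Real.sqrt_nonneg _

end StepBounds

/-! ### The theorem -/

/-- **Rough polarization with a polynomially small unpolarized fraction, for an abstract
polarization tree** (`μ = 1/80`, `C = 2`): for every type `𝒮`, every `P : StepBounds 𝒮`
(Arıkan's one-step relations `H⁻ + H⁺ = 2H`, `Z⁺ = Z²`, `Z√(2−Z²) ≤ Z⁻ ≤ 2Z − Z²`,
`Z² ≤ H ≤ log₂(1+Z)`), every root `h` and every depth `s`, at most `2 · 2^{(79/80) s}` of the `2^s`
leaves have `H ∈ (2^{-s/80}, 1 − 2^{-s/80})`.  Source/channel polarization [Arıkan 2010, Thm 1]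
made quantitative and UNIVERSAL (constants independent of the process) by the Bhattacharyya
supermartingale (`Z⁺ = Z²`, `Z⁻ ≤ 2Z − Z²`, with the Korada–Urbanke lower bound
`Z⁻ ≥ Z√(2−Z²)`), the simultaneous polarization of `H` and `Z` (Prop. 2), and a
Mondelli–Hassani–Urbanke potential (`StepBounds.card_window_mul_le`, `rate_pow_le`).
[cite: Arikan2010, Thm 1 and Prop. 1–2 (polarization via the Bhattacharyya supermartingale; universal polynomial rate as in GuruswamiXia2015 / MondelliHassaniUrbanke2016 Lemmas 5–6)] -/
theorem rough_polarization : ∃ μ : ℝ, 0 < μ ∧ ∃ C : ℝ, ∀ (𝒮 : Type u) (P : StepBounds 𝒮) (h : 𝒮)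
    (s : ℕ), ((Finset.univ.filter fun j : Fin (2 ^ s) =>
        (2 : ℝ) ^ (-(μ * s)) < P.H (leaf P.minus P.plus s h j) ∧
          P.H (leaf P.minus P.plus s h j) < 1 - (2 : ℝ) ^ (-(μ * s))).card : ℝ)
      ≤ C * (2 : ℝ) ^ ((1 - μ) * s) := by
  refine ⟨1 / 80, by norm_num, 2, ?_⟩
  intro 𝒮 P h s
  set ε : ℝ := (2 : ℝ) ^ (-((1 : ℝ) / 80 * s)) with hε
  have hE : 0 < (2 : ℝ) ^ ((1 : ℝ) / 80 * s) := Real.rpow_pos_of_pos two_pos _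
  have hε0 : 0 < ε := Real.rpow_pos_of_pos two_pos _
  have hεE : ε * (2 : ℝ) ^ ((1 : ℝ) / 80 * s) = 1 := by
    rw [hε, Real.rpow_neg zero_le_two]
    exact inv_mul_cancel₀ hE.ne'
  have key : ((univ.filter fun j : Fin (2 ^ s) => ε < P.H (leaf P.minus P.plus s h j) ∧
      P.H (leaf P.minus P.plus s h j) < 1 - ε).card : ℝ) * (ε / 2) ≤ (39 / 20) ^ s :=
    (P.card_window_mul_le h s hε0).trans (pow_le_pow_left₀ (by norm_num) (by norm_num) s)
  calc ((univ.filter fun j : Fin (2 ^ s) => ε < P.H (leaf P.minus P.plus s h j) ∧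
        P.H (leaf P.minus P.plus s h j) < 1 - ε).card : ℝ)
      = ((univ.filter fun j : Fin (2 ^ s) => ε < P.H (leaf P.minus P.plus s h j) ∧
          P.H (leaf P.minus P.plus s h j) < 1 - ε).card : ℝ) * (ε / 2) *
          (2 * (2 : ℝ) ^ ((1 : ℝ) / 80 * s)) := by
        rw [mul_assoc, show ε / 2 * (2 * (2 : ℝ) ^ ((1 : ℝ) / 80 * s)) =
          ε * (2 : ℝ) ^ ((1 : ℝ) / 80 * s) by ring, hεE, mul_one]
    _ ≤ (39 / 20) ^ s * (2 * (2 : ℝ) ^ ((1 : ℝ) / 80 * s)) :=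
        mul_le_mul_of_nonneg_right key (by positivity)
    _ = 2 * ((39 / 20) ^ s * (2 : ℝ) ^ ((1 : ℝ) / 80 * s)) := by ring
    _ ≤ 2 * (2 : ℝ) ^ ((1 - (1 : ℝ) / 80) * s) :=
        mul_le_mul_of_nonneg_left (rate_pow_le s) zero_le_two

end Literature.InformationTheory.Coding.PolarTree
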